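import Mathlib
import Summits.MatrixMultiplication.MatrixMultiplication.Theses.ThinBlockAlpha

set_option linter.dupNamespace false

/-!
# Stub `stub_transfer` — multiplicatively-STPP segment configurations give `IsSTPP` families in `Additive Fˣ`

Crux `stmt-MatrixMultiplication-10595` (`Theses.ThinBlockAlpha.ThinPackings`), line
`log-flat-cyclic-designs`.

* `stub_transfer` — the registered stub (skeleton reshape v2), **the packaging**: for a prime `p`, a field `F`
  that is an `𝔽_p`-algebra, and a configuration of `L` segment triples `c ↦ x i + c`, `c ↦ y i + ξ i c`,
  `c ↦ z i + ζ i c` (`c ∈ 𝔽_p`) consisting of units, with nonzero directions `ξ i, ζ i`, a middle box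
  `𝒮 ⊆ 𝔽_p`, and the multiplicative simultaneous triple product property of the configuration, there is an
  honest `IsSTPP` family in the abelian group `Additive Fˣ` with legs of sizes `p − 1`, `|𝒮|`, `p − 1`: the
  images of `𝔽_p ∖ {0}`, `𝒮`, `𝔽_p ∖ {0}` under the three segment maps into the units, read additively.  The
  maps are injective (`algebraMap (ZMod p) F` is injective since `ZMod p` is a field, and a unit is determined
  by its value), which gives the cardinalities; the additive STPP relation `(s' − s) + (t' − t) + (u' − u) = 0`
  in `Additive Fˣ` is the identity `s' t' u' = s t u` of field elements, i.e. exactly the hypothesis' identity,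
  whose conclusion `i = j = k`, `τ = τ'`, `σ = σ'`, `ρ = ρ'` forces `s = s'`, `t = t'`, `u = u'`.
* `thinPackings_of_logFlatThin` — the same stub in the form of skeleton reshape r1 (`LogFlatThin → ThinPackings`
  with the line's `LogFlatThin` unfolded): adding the real-number bookkeeping `N := p − 1 ≥ 2` (from `3 ≤ p`),
  `M := |𝒮| ≥ N^a`, `|Additive Fˣ| = |F| − 1 ≤ L · N^{2+η}` (`Fintype.card_units`), a thin two-leg-tight
  configuration for every `a < 1`, `η > 0` gives the crux `ThinPackings` itself.

Both are sorry-free consequences of Mathlib alone (no cited facts).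
-/

namespace Summit.MatrixMultiplication.MatrixMultiplication.Theorems.ThinPackings

open Finset
open Literature.Computability.AlgebraicComplexity (IsSTPP)
open Summit.MatrixMultiplication.MatrixMultiplication.Theses.ThinBlockAlpha (ThinPackings)

/-- Reading an additive six-term STPP relation among units `Units.mk0 _ _` of a commutative group with
zero, placed in `Additive G₀ˣ`, as the multiplicative identity `s' * t' * u' = s * t * u` of the
underlying elements. -/
private theorem mul_eq_of_additive_rel {G₀ : Type*} [CommGroupWithZero G₀] {s s' t t' u u' : G₀}
    {hs : s ≠ 0} {hs' : s' ≠ 0} {ht : t ≠ 0} {ht' : t' ≠ 0} {hu : u ≠ 0} {hu' : u' ≠ 0}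
    (h : Additive.ofMul (Units.mk0 s' hs') - Additive.ofMul (Units.mk0 s hs) +
          (Additive.ofMul (Units.mk0 t' ht') - Additive.ofMul (Units.mk0 t ht)) +
          (Additive.ofMul (Units.mk0 u' hu') - Additive.ofMul (Units.mk0 u hu)) = 0) :
    s' * t' * u' = s * t * u := by
  have h1 : Additive.ofMul (Units.mk0 s' hs') + Additive.ofMul (Units.mk0 t' ht') +
        Additive.ofMul (Units.mk0 u' hu') =
      Additive.ofMul (Units.mk0 s hs) + Additive.ofMul (Units.mk0 t ht) +
        Additive.ofMul (Units.mk0 u hu) := by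
    rw [← sub_eq_zero, ← h]; abel
  have h2 := congrArg (fun w : Additive G₀ˣ => ((Additive.toMul w : G₀ˣ) : G₀)) h1
  simpa only [toMul_add, toMul_ofMul, Units.val_mul, Units.val_mk0] using h2

/-- The segment map `c ↦ w + m • c` into the units of an `𝔽_p`-algebra field, read additively, is
injective as soon as `m ≠ 0` (and `p` is prime, so that `algebraMap (ZMod p) F` is injective). -/
private theorem segment_injective {p : ℕ} [Fact p.Prime] {F : Type*} [Field F] [Algebra (ZMod p) F]
    (w m : F) (hm : m ≠ 0) (h : ∀ c : ZMod p, w + m * algebraMap (ZMod p) F c ≠ 0) :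
    Function.Injective
      (fun c : ZMod p => Additive.ofMul (Units.mk0 (w + m * algebraMap (ZMod p) F c) (h c))) := by
  intro c c' hcc'
  have h1 := congrArg (fun v : Additive Fˣ => ((Additive.toMul v : Fˣ) : F)) hcc'
  simp only [toMul_ofMul, Units.val_mk0, add_right_inj] at h1
  exact (algebraMap (ZMod p) F).injective (mul_left_cancel₀ hm h1)

/-- The same for the unit-slope segment map `c ↦ w + c`. -/
private theorem segment_injective_one {p : ℕ} [Fact p.Prime] {F : Type*} [Field F]
    [Algebra (ZMod p) F] (w : F) (h : ∀ c : ZMod p, w + algebraMap (ZMod p) F c ≠ 0) :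
    Function.Injective
      (fun c : ZMod p => Additive.ofMul (Units.mk0 (w + algebraMap (ZMod p) F c) (h c))) := by
  intro c c' hcc'
  have h1 := congrArg (fun v : Additive Fˣ => ((Additive.toMul v : Fˣ) : F)) hcc'
  simp only [toMul_ofMul, Units.val_mk0, add_right_inj] at h1
  exact (algebraMap (ZMod p) F).injective h1

/-- **STUB `stub_transfer`** of line `log-flat-cyclic-designs` (registered signature, skeleton reshape v2) —
**the packaging of a multiplicatively-STPP unit-valued segment configuration into `Additive Fˣ`**: for a prime
`p`, a field `F ⊇ 𝔽_p`, a configuration `(x, y, z, ξ, ζ : Fin L → F, 𝒮 ⊆ 𝔽_p)` with nonzero directions,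
unit-valued legs and the multiplicative STPP, there is an `IsSTPP` family in `Additive Fˣ` with
`|A i| = |C i| = p − 1` and `|B i| = |𝒮|`: the legs are the images of `𝔽_p ∖ {0}`, `𝒮`, `𝔽_p ∖ {0}` under the
injective maps `c ↦ x i + c`, `c ↦ y i + ξ i c`, `c ↦ z i + ζ i c` into the units (`Units.mk0`), and the
additive relation `(s' − s) + (t' − t) + (u' − u) = 0` read through `Additive.toMul` is the field identity of
the hypothesis. (The hypotheses `Fintype F` and `0 ∉ 𝒮` are part of the registered statement and not used.)
[new; routine packaging] -/
theorem stub_transfer :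
    ∀ (p : ℕ) (F : Type) [Field F] [Fintype F] [Algebra (ZMod p) F] (L : ℕ)
      (x y z ξ ζ : Fin L → F) (S : Finset (ZMod p)),
      p.Prime → (0 : ZMod p) ∉ S →
      (∀ i, ξ i ≠ 0 ∧ ζ i ≠ 0) →
      (∀ i (c : ZMod p), x i + algebraMap (ZMod p) F c ≠ 0 ∧
        y i + ξ i * algebraMap (ZMod p) F c ≠ 0 ∧ z i + ζ i * algebraMap (ZMod p) F c ≠ 0) →
      (∀ i j k : Fin L, ∀ τ τ' σ σ' ρ ρ' : ZMod p, τ ≠ 0 → τ' ≠ 0 → ρ ≠ 0 → ρ' ≠ 0 → σ ∈ S → σ' ∈ S →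
        (x i + algebraMap (ZMod p) F τ') * (y j + ξ j * algebraMap (ZMod p) F σ') *
            (z k + ζ k * algebraMap (ZMod p) F ρ') =
          (x k + algebraMap (ZMod p) F τ) * (y i + ξ i * algebraMap (ZMod p) F σ) *
            (z j + ζ j * algebraMap (ZMod p) F ρ) →
        i = j ∧ j = k ∧ τ = τ' ∧ σ = σ' ∧ ρ = ρ') →
      ∃ (A B C : Fin L → Finset (Additive Fˣ)),
        Literature.Computability.AlgebraicComplexity.IsSTPP A B C ∧
        ∀ i, (A i).card = p - 1 ∧ (B i).card = S.card ∧ (C i).card = p - 1 := by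
  intro p F _ _ _ L x y z ξ ζ S hp _ hdir hnd hmul
  classical
  haveI : Fact p.Prime := ⟨hp⟩
  refine ⟨fun i => (Finset.univ.erase (0 : ZMod p)).image
      (fun τ : ZMod p => Additive.ofMul (Units.mk0 (x i + algebraMap (ZMod p) F τ) (hnd i τ).1)),
    fun i => S.image
      (fun σ : ZMod p =>
        Additive.ofMul (Units.mk0 (y i + ξ i * algebraMap (ZMod p) F σ) (hnd i σ).2.1)),
    fun i => (Finset.univ.erase (0 : ZMod p)).image
      (fun ρ : ZMod p =>
        Additive.ofMul (Units.mk0 (z i + ζ i * algebraMap (ZMod p) F ρ) (hnd i ρ).2.2)),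
    ?_, ?_⟩
  · -- the simultaneous triple product property, read through `Additive.toMul`
    intro i j k s hs s' hs' t ht t' ht' u hu u' hu' hrel
    simp only [Finset.mem_image, Finset.mem_erase, Finset.mem_univ, and_true] at hs hs' ht ht' hu hu'
    obtain ⟨τ, hτ, rfl⟩ := hs
    obtain ⟨τ', hτ', rfl⟩ := hs'
    obtain ⟨σ, hσ, rfl⟩ := ht
    obtain ⟨σ', hσ', rfl⟩ := ht'
    obtain ⟨ρ, hρ, rfl⟩ := hu
    obtain ⟨ρ', hρ', rfl⟩ := hu'
    have key := mul_eq_of_additive_rel hrel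
    obtain ⟨hij, hjk, hττ', hσσ', hρρ'⟩ := hmul i j k τ τ' σ σ' ρ ρ' hτ hτ' hρ hρ' hσ hσ' key
    subst hij hjk hττ' hσσ' hρρ'
    exact ⟨rfl, rfl, rfl, rfl, rfl⟩
  · -- cardinalities: the three segment maps are injective
    intro i
    have hcard0 : (Finset.univ.erase (0 : ZMod p)).card = p - 1 := by
      rw [Finset.card_erase_of_mem (Finset.mem_univ _), Finset.card_univ, ZMod.card]
    refine ⟨?_, ?_, ?_⟩
    · rw [Finset.card_image_of_injective _ (segment_injective_one (x i) (fun c => (hnd i c).1)),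
        hcard0]
    · rw [Finset.card_image_of_injective _
        (segment_injective (y i) (ξ i) (hdir i).1 (fun c => (hnd i c).2.1))]
    · rw [Finset.card_image_of_injective _
        (segment_injective (z i) (ζ i) (hdir i).2 (fun c => (hnd i c).2.2)), hcard0]

/-- **`LogFlatThin → ThinPackings`** (the same stub in the form of skeleton reshape r1, the hypothesis being
the line's `LogFlatThin` unfolded): a thin, two-leg-tight, nondegenerate, multiplicatively-STPP segment
configuration over a finite field `F` of odd prime characteristic `p`, for every `a < 1` and `η > 0`, gives the
crux `ThinPackings` with `H := Additive Fˣ`, `N := p − 1 ≥ 2`, `M := |𝒮| ≥ N^a`, the `IsSTPP` family of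
`stub_transfer`, and `|H| = |F| − 1 ≤ L · N^{2+η}` (`Fintype.card_units`). [new; routine packaging] -/
theorem thinPackings_of_logFlatThin :
    (∀ a : ℝ, 0 ≤ a → a < 1 → ∀ η : ℝ, 0 < η →
      ∃ (p : ℕ) (F : Type) (_ : Field F) (_ : Fintype F) (_ : Algebra (ZMod p) F) (L : ℕ)
        (x y z ξ ζ : Fin L → F) (S : Finset (ZMod p)),
        p.Prime ∧ 3 ≤ p ∧ (0 : ZMod p) ∉ S ∧
        (∀ i, ξ i ≠ 0 ∧ ζ i ≠ 0) ∧
        (∀ i (c : ZMod p), x i + algebraMap (ZMod p) F c ≠ 0 ∧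
          y i + ξ i * algebraMap (ZMod p) F c ≠ 0 ∧ z i + ζ i * algebraMap (ZMod p) F c ≠ 0) ∧
        (∀ i j k : Fin L, ∀ τ τ' σ σ' ρ ρ' : ZMod p, τ ≠ 0 → τ' ≠ 0 → ρ ≠ 0 → ρ' ≠ 0 → σ ∈ S → σ' ∈ S →
          (x i + algebraMap (ZMod p) F τ') * (y j + ξ j * algebraMap (ZMod p) F σ') *
              (z k + ζ k * algebraMap (ZMod p) F ρ') =
            (x k + algebraMap (ZMod p) F τ) * (y i + ξ i * algebraMap (ZMod p) F σ) *
              (z j + ζ j * algebraMap (ZMod p) F ρ) →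
          i = j ∧ j = k ∧ τ = τ' ∧ σ = σ' ∧ ρ = ρ') ∧
        (((p - 1 : ℕ) : ℝ) ^ a ≤ S.card) ∧
        (((Fintype.card F - 1 : ℕ) : ℝ) ≤ L * ((p - 1 : ℕ) : ℝ) ^ (2 + η))) →
    Summit.MatrixMultiplication.MatrixMultiplication.Theses.ThinBlockAlpha.ThinPackings := by
  intro h a ha0 ha1 η hη
  obtain ⟨p, F, iF, iFin, iAlg, L, x, y, z, ξ, ζ, S, hp, hp3, hS0, hdir, hnd, hmul, hSa, hsize⟩ :=
    h a ha0 ha1 η hη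
  classical
  obtain ⟨A, B, C, hstpp, hcards⟩ := stub_transfer p F L x y z ξ ζ S hp hS0 hdir hnd hmul
  refine ⟨Additive Fˣ, inferInstance, inferInstance, L, p - 1, S.card, A, B, C, hstpp, hcards, ?_,
    hSa, ?_⟩
  · -- 2 ≤ p - 1
    omega
  · -- |Additive Fˣ| = |F| - 1 ≤ L · (p - 1)^{2+η}
    rw [Fintype.card_additive, Fintype.card_units]
    exact hsize

end Summit.MatrixMultiplication.MatrixMultiplication.Theorems.ThinPackings
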